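import Summits.Ventures.CertifiedArithmetic.LowPrec.GemmThetaLawGenDefs

/-!
# The E2M1² all-precision law as `LawData`, checked in the kernel for every `p ≥ 8`

HONEST FRAMING (venture CertifiedArithmetic / cell `pub-lowprec`, seat gemm, gen 12 → 13): certified
error envelopes and provably optimal rounding/accumulation schemes for low-precision formats under
stated cost models; every table by two implementations; no hardware or vendor claims.

`e2m1Law` is the product alphabet E2M1 × E2M1 (quarter units) with the law of paper `gemm.tex`
Theorem t:thetap (`ψ` tables `B = (2,3,4,6,7,9,13,21)`, `S = (2,2,4,2,4,8,16,32)`, `J = 7`,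
`θ = (13M + 16)/64 = 13·2^(p-7) + 1/4`, `κ = 1/θ`, `ρ = 7/2`, `β_pair = 23/2`) in the symbolic regime
`M = 64K`, `K ≥ 2`, i.e. EVERY `p ≥ 8` (one binade lower than the band scheme of
`GemmThetaLawE2M1.lean`, which needs `p ≥ 9`).  `nclasses_e2m1`: the generator serves exactly the
2,402 classes of the design aid `symsplit_proto.py e2m1 7`; `lawCheck_e2m1`: ALL facts and the
coverage chains pass (`LawData.lawCheck`, one kernel `decide`, ≈ 55 s).  This is the executable half
of the letter-dependent certificate; the soundness layer (facts ⇒ `ThetaCertificate`, as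
`GemmThetaLawE2M1Sound/Edge/Law` did for the band scheme) turns it into `thetaCert` for all `p ≥ 8`
and is the template for the FP6 / mixed laws (t:thetap6 / t:thetapmix).
-/

namespace Literature.ComputerArithmetic.FloatingPoint

namespace MiniFloat

namespace ThetaLaw

/-! ### The E2M1² law as data, and its check -/

/-- E2M1 × E2M1 products (quarter units) with the law of gemm.tex Thm t:thetap:
`ψ` tables `B = (2,3,4,6,7,9,13,21)`, `S = (2,2,4,2,4,8,16,32)`, `J = 7`, `θ = (13M + 16)/64`,
`κ = 64/(13M + 16)`, `ρ = 7/2`, `β_pair = 23/2`; symbolic regime `M = 64K`, `K ≥ 2` (every `p ≥ 8`).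
[cell, laws.py] -/
def e2m1Law : LawData :=
  { X := [1, 2, 3, 4, 6, 8, 9, 12, 16, 18, 24, 32, 36, 48, 64, 72, 96, 144], J := 7,
    B := [2, 3, 4, 6, 7, 9, 13, 21], S := [2, 2, 4, 2, 4, 8, 16, 32],
    th1 := 13, th0 := 16, thD := 64, kb := 6, rhoN := 7, rhoD := 2, betaN := 23, betaD := 2,
    M0 := 64, K0 := 2, fixed := false }

/-- The generator serves exactly 2,402 classes for E2M1² (= the design aid's count). [cell, kernel] -/
theorem nclasses_e2m1 : (e2m1Law.levels.flatMap fun lev => [1, -1].flatMap fun sgn =>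
    e2m1Law.lam.flatMap fun q => e2m1Law.mainClasses lev sgn q).length = 2402 := by
  decide +kernel

/-- THE E2M1² LAW CHECK PASSES for every `p ≥ 8`: all facts of all 2,402 classes (incl. the pair
tables of the free moves) and all coverage chains. [cell, kernel `decide`, ≈ 55 s] -/
theorem lawCheck_e2m1 : e2m1Law.lawCheck = true := by
  decide +kernel

end ThetaLaw

end MiniFloat

end Literature.ComputerArithmetic.FloatingPoint
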